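import Mathlib

/-!
# Stub `stub_actContinuous` for line `Sketch` of crux `FixedPointFreeTargets`
(stmt-MatrixMultiplication-15042)

Each `act g` of the pinned Pauli sandwich action on tensors
`V = (I × I) → (I × I) → (I × I) → ℂ`, `I = Fin k → ZMod p`, is continuous for the product
topology: by `hact` every coordinate of `act g x` is a finite sum of constants times coordinates
of `x`.
-/

set_option linter.dupNamespace false

noncomputable section

namespace Summit.MatrixMultiplication.MatrixMultiplication.Theorems

open scoped BigOperators ComplexConjugate

namespace PauliTautologicalTarget

section Pinned

variable {p k : ℕ}
  {P : (Fin k → ZMod p) → (Fin k → ZMod p) → Matrix (Fin k → ZMod p) (Fin k → ZMod p) ℂ}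
  {act : ((Fin k → ZMod p) × (Fin k → ZMod p)) × ((Fin k → ZMod p) × (Fin k → ZMod p)) ×
      ((Fin k → ZMod p) × (Fin k → ZMod p)) →
    (((Fin k → ZMod p) × (Fin k → ZMod p)) → ((Fin k → ZMod p) × (Fin k → ZMod p)) →
      ((Fin k → ZMod p) × (Fin k → ZMod p)) → ℂ) →
    (((Fin k → ZMod p) × (Fin k → ZMod p)) → ((Fin k → ZMod p) × (Fin k → ZMod p)) →
      ((Fin k → ZMod p) × (Fin k → ZMod p)) → ℂ)}

/-- Each `act g` of the pinned sandwich action is continuous (it is linear in finitely many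
coordinates). -/
theorem stub_actContinuous [Fact p.Prime]
    (hact : ∀ g x a b c, act g x a b c = ∑ a', ∑ b', ∑ c',
      (starRingEnd ℂ (P g.1.1 g.1.2 a.1 a'.1) * P g.2.2.1 g.2.2.2 a.2 a'.2) *
      (P g.1.1 g.1.2 b.1 b'.1 * starRingEnd ℂ (P g.2.1.1 g.2.1.2 b.2 b'.2)) *
      (P g.2.1.1 g.2.1.2 c.1 c'.1 * starRingEnd ℂ (P g.2.2.1 g.2.2.2 c.2 c'.2)) * x a' b' c')
    (g : ((Fin k → ZMod p) × (Fin k → ZMod p)) × ((Fin k → ZMod p) × (Fin k → ZMod p)) ×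
      ((Fin k → ZMod p) × (Fin k → ZMod p))) :
    Continuous (act g) := by
  have hg : act g = fun x a b c => ∑ a', ∑ b', ∑ c',
      (starRingEnd ℂ (P g.1.1 g.1.2 a.1 a'.1) * P g.2.2.1 g.2.2.2 a.2 a'.2) *
      (P g.1.1 g.1.2 b.1 b'.1 * starRingEnd ℂ (P g.2.1.1 g.2.1.2 b.2 b'.2)) *
      (P g.2.1.1 g.2.1.2 c.1 c'.1 * starRingEnd ℂ (P g.2.2.1 g.2.2.2 c.2 c'.2)) * x a' b' c' :=
    funext fun x => funext fun a => funext fun b => funext fun c => hact g x a b c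
  rw [hg]
  refine continuous_pi fun a => continuous_pi fun b => continuous_pi fun c => ?_
  refine continuous_finsetSum _ fun a' _ => continuous_finsetSum _ fun b' _ =>
    continuous_finsetSum _ fun c' _ => continuous_const.mul ?_
  exact (continuous_apply c').comp ((continuous_apply b').comp (continuous_apply a'))

end Pinned

end PauliTautologicalTarget

end Summit.MatrixMultiplication.MatrixMultiplication.Theorems
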